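import Literature.MathematicalPhysics.KineticTheory.HardSphereEulerProofs
import HarnessLib

/-!
# From a fixed-point floor to a uniform floor (stub `floorChain`)

Supporting file of the line `Sketch` (card `adiabat-pricing-of-the-ceiling`) for the crux
`AprioriBounds` (stmt-AtomisticToContinuum-14827), proving the registered stub `stub_floorChain`
of the lead's skeleton (reshape r3) VERBATIM.  It is pure bookkeeping: given

1. a FIXED-`(s, x)` bound `P_N{ρ̄_N(Φ_s z, x) < c₁} ≤ δ_N` for `s ∈ [0, t]`, `x ∈ 𝕋³`, with
   `(N+1)² δ_N → 0` (block density `ρ̄_N(w, x) = empiricalDensityField w (φ_N (· - x))`);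
2. the deterministic space–time modulus on good orbits of energy `≤ K(N+1)`:
   `|ρ̄_N(Φ_s z, x) - ρ̄_N(Φ_{s'} z, x')| ≤ Lip_N (‖x - x'‖ + |s - s'| √(2K))`,
   `Lip_N = √3 · C (N+1)^{4γ}`;
3. `P_N{z ∉ good ∨ K(N+1) < E(z)} → 0`,

the block density is `≥ c₁ / 2` at ALL times `s ∈ [0, t]` and ALL centres `x`, w.h.p.

## Proof

* Grid cover of `𝕋³` (`floorChain_exists_gridPoint`): every `x : 𝕋³` is within sup-distance
  `1/m` of a point of the cubic grid `gridPoint m k`, `k ∈ {0, …, m-1}³`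
  (`HardSphereEulerProofs`): lift each coordinate to `y ∈ ℝ`, take `k = ⌊m · fract y⌋₊` and use
  `‖(u : ℝ/ℤ)‖ = |u - round u| ≤ |u - ⌊y⌋|`.
* Time grid `s_j = j h`, `j ≤ ⌊t/h⌋₊` (`floorChain_exists_timeGrid`, `floorChain_timeGrid_mem`).
* Union bound at fixed `N` over an abstract measurable space (`floorChain_measure_le`): with
  `Lip/m ≤ c₁/4` and `Lip √(2K) h ≤ c₁/4` the bad event is inside
  `{cap fails} ∪ ⋃_{j,k} {ρ̄(Φ_{s_j} z, x_k) < c₁}`, so its (outer) measure is at most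
  `P_N{cap fails} + (⌊t/h⌋₊ + 1) m³ δ_N` (`measure_mono`, `measure_union_le`,
  `measure_iUnion_fintype_le`; no measurability needed).
* Counting (`floorChain_grid_params_of_le`, `floorChain_exists_grid_params`): with
  `m = ⌈4 Lip/c₁⌉₊ + 1`, `h = c₁ / (4 Lip √(2K) + 1)` the number of grid points is
  `≤ A (N+1)^{16γ} ≤ A (N+1)²` (`16γ ≤ 16/15 ≤ 2`), whence `card · δ_N ≤ A (N+1)² |δ_N| → 0`
  and the squeeze in `ℝ≥0∞`.

No new definitions, no named facts; axioms `propext`, `Classical.choice`, `Quot.sound`.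
-/

noncomputable section

open MeasureTheory Filter Set Topology
open scoped ENNReal

namespace Summit.AtomisticToContinuum.HydrodynamicLimit.Theorems.AdiabatCeiling

open Literature.MathematicalPhysics.KineticTheory Literature.Analysis.FluidPDE

/-! ## The space grid -/

/-- **Grid cover of the torus.** For `0 < m`, every point of `𝕋³` is within sup-distance `1/m`
of a point of the cubic grid `(m⁻¹ℤ/ℤ)³`: coordinatewise, lift `x l = ↑y`, put
`k = ⌊m · fract y⌋₊ < m`; then `‖↑y - ↑(k/m)‖ ≤ |y - k/m - ⌊y⌋| = |fract y - k/m| ≤ 1/m`. -/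
theorem floorChain_exists_gridPoint {m : ℕ} (hm : 0 < m) (x : T3) :
    ∃ k : Fin 3 → Fin m, ‖x - gridPoint m k‖ ≤ 1 / (m : ℝ) := by
  have hm' : (0 : ℝ) < m := by exact_mod_cast hm
  have hy : ∀ l, ∃ y : ℝ, (y : UnitAddCircle) = x l := fun l => QuotientAddGroup.mk_surjective (x l)
  choose y hy using hy
  have hk : ∀ l, ⌊(m : ℝ) * Int.fract (y l)⌋₊ < m := fun l => by
    rw [Nat.floor_lt (mul_nonneg hm'.le (Int.fract_nonneg _))]
    calc (m : ℝ) * Int.fract (y l) < m * 1 :=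
          mul_lt_mul_of_pos_left (Int.fract_lt_one _) hm'
      _ = m := mul_one _
  refine ⟨fun l => ⟨_, hk l⟩, ?_⟩
  rw [pi_norm_le_iff_of_nonneg (by positivity)]
  intro l
  rw [Pi.sub_apply, gridPoint_apply, Fin.val_mk, ← hy l, ← AddCircle.coe_sub,
    UnitAddCircle.norm_eq]
  refine (round_le _ ⌊y l⌋).trans ?_
  set k : ℕ := ⌊(m : ℝ) * Int.fract (y l)⌋₊ with hk_def
  have h1 : (k : ℝ) ≤ m * Int.fract (y l) := Nat.floor_le (mul_nonneg hm'.le (Int.fract_nonneg _))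
  have h2 : (m : ℝ) * Int.fract (y l) < k + 1 := Nat.lt_floor_add_one _
  have hfr : Int.fract (y l) = y l - ⌊y l⌋ := rfl
  have key : y l - (k : ℝ) / m - (⌊y l⌋ : ℝ) = ((m : ℝ) * Int.fract (y l) - k) / m := by
    rw [hfr]
    field_simp
    ring
  have habs : |(m : ℝ) * Int.fract (y l) - k| ≤ 1 := by
    rw [abs_le]
    constructor <;> linarith
  rw [key, abs_div, abs_of_pos hm']
  exact div_le_div_of_nonneg_right habs hm'.le

/-! ## The time grid -/

/-- The time grid `j h`, `j ≤ ⌊t/h⌋₊`, lies in `[0, t]`. -/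
theorem floorChain_timeGrid_mem {h t : ℝ} (hh : 0 < h) (ht : 0 ≤ t) (j : Fin (⌊t / h⌋₊ + 1)) :
    ((j : ℕ) : ℝ) * h ∈ Icc 0 t := by
  refine ⟨by positivity, ?_⟩
  have hj : (j : ℕ) ≤ ⌊t / h⌋₊ := Nat.lt_succ_iff.mp j.isLt
  have : ((j : ℕ) : ℝ) ≤ t / h := (Nat.cast_le.mpr hj).trans (Nat.floor_le (by positivity))
  rwa [le_div_iff₀ hh] at this

/-- Every `s ∈ [0, t]` is within `h` of the time grid: `j = ⌊s/h⌋₊`. -/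
theorem floorChain_exists_timeGrid {h t s : ℝ} (hh : 0 < h) (hs : s ∈ Icc 0 t) :
    ∃ j : Fin (⌊t / h⌋₊ + 1), |s - ((j : ℕ) : ℝ) * h| ≤ h := by
  refine ⟨⟨⌊s / h⌋₊, Nat.lt_succ_of_le
    (Nat.floor_le_floor (div_le_div_of_nonneg_right hs.2 hh.le))⟩, ?_⟩
  have h1 : (⌊s / h⌋₊ : ℝ) ≤ s / h := Nat.floor_le (div_nonneg hs.1 hh.le)
  have h2 : s / h < ⌊s / h⌋₊ + 1 := Nat.lt_floor_add_one _
  rw [le_div_iff₀ hh] at h1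
  rw [div_lt_iff₀ hh] at h2
  rw [abs_le]
  constructor <;> nlinarith

/-! ## The union bound at fixed `N` -/

/-- **Union bound.** On an abstract measure space: if `F s z x` has the space–time modulus
`|F s z x - F s' z x'| ≤ Lip (‖x - x'‖ + |s - s'| M)` for `z` good with `E z ≤ cap`, if
`Lip / m ≤ c₁/4` and `Lip M h ≤ c₁/4`, and if `μ{F s · x < c₁} ≤ d` at every fixed
`s ∈ [0, t]`, `x`, then `μ{∃ s ∈ [0,t], ∃ x, F s · x < c₁/2} ≤ μ{¬ good ∨ cap < E} +
(⌊t/h⌋₊ + 1) m³ d` (outer-measure bounds; no measurability is needed). -/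
theorem floorChain_measure_le {Ω : Type*} [MeasurableSpace Ω] (μ : Measure Ω) (G : Set Ω)
    (E : Ω → ℝ) (cap : ℝ) (F : ℝ → Ω → T3 → ℝ) {Lip M t c₁ h : ℝ} {m : ℕ} {d : ℝ≥0∞}
    (hLip : 0 ≤ Lip) (hM : 0 ≤ M) (ht : 0 < t) (hh : 0 < h) (hm : 0 < m)
    (hmod : ∀ z ∈ G, E z ≤ cap → ∀ (s s' : ℝ) (x x' : T3),
      |F s z x - F s' z x'| ≤ Lip * (‖x - x'‖ + |s - s'| * M))
    (hspace : Lip * (1 / (m : ℝ)) ≤ c₁ / 4) (htime : Lip * M * h ≤ c₁ / 4)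
    (hfix : ∀ s ∈ Icc 0 t, ∀ x : T3, μ {z | F s z x < c₁} ≤ d) :
    μ {z | ∃ s ∈ Icc 0 t, ∃ x : T3, F s z x < c₁ / 2} ≤
      μ {z | z ∉ G ∨ cap < E z} + (((⌊t / h⌋₊ + 1) * m ^ 3 : ℕ) : ℝ≥0∞) * d := by
  have hsub : {z | ∃ s ∈ Icc 0 t, ∃ x : T3, F s z x < c₁ / 2} ⊆
      {z | z ∉ G ∨ cap < E z} ∪ ⋃ i : Fin (⌊t / h⌋₊ + 1) × (Fin 3 → Fin m),
        {z | F (((i.1 : ℕ) : ℝ) * h) z (gridPoint m i.2) < c₁} := by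
    rintro z ⟨s, hs, x, hx⟩
    by_cases hc : z ∉ G ∨ cap < E z
    · exact Or.inl hc
    push Not at hc
    obtain ⟨hzG, hzE⟩ := hc
    obtain ⟨j, hj⟩ := floorChain_exists_timeGrid hh hs
    obtain ⟨k, hk⟩ := floorChain_exists_gridPoint hm x
    refine Or.inr (mem_iUnion.2 ⟨(j, k), ?_⟩)
    simp only [mem_setOf_eq]
    have hmod' := hmod z hzG hzE s (((j : ℕ) : ℝ) * h) x (gridPoint m k)
    have hB : Lip * (‖x - gridPoint m k‖ + |s - ((j : ℕ) : ℝ) * h| * M) ≤ c₁ / 4 + c₁ / 4 := by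
      rw [mul_add]
      refine add_le_add ((mul_le_mul_of_nonneg_left hk hLip).trans hspace) ?_
      calc Lip * (|s - ((j : ℕ) : ℝ) * h| * M) ≤ Lip * (h * M) :=
            mul_le_mul_of_nonneg_left (mul_le_mul_of_nonneg_right hj hM) hLip
        _ = Lip * M * h := by ring
        _ ≤ c₁ / 4 := htime
    have h1 := (abs_le.1 (hmod'.trans hB)).1
    linarith
  calc μ {z | ∃ s ∈ Icc 0 t, ∃ x : T3, F s z x < c₁ / 2}
      ≤ μ ({z | z ∉ G ∨ cap < E z} ∪ ⋃ i : Fin (⌊t / h⌋₊ + 1) × (Fin 3 → Fin m),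
          {z | F (((i.1 : ℕ) : ℝ) * h) z (gridPoint m i.2) < c₁}) := measure_mono hsub
    _ ≤ μ {z | z ∉ G ∨ cap < E z} + μ (⋃ i : Fin (⌊t / h⌋₊ + 1) × (Fin 3 → Fin m),
          {z | F (((i.1 : ℕ) : ℝ) * h) z (gridPoint m i.2) < c₁}) := measure_union_le _ _
    _ ≤ μ {z | z ∉ G ∨ cap < E z} + ∑ i : Fin (⌊t / h⌋₊ + 1) × (Fin 3 → Fin m),
          μ {z | F (((i.1 : ℕ) : ℝ) * h) z (gridPoint m i.2) < c₁} :=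
        add_le_add le_rfl (measure_iUnion_fintype_le μ _)
    _ ≤ μ {z | z ∉ G ∨ cap < E z} + ∑ _i : Fin (⌊t / h⌋₊ + 1) × (Fin 3 → Fin m), d :=
        add_le_add le_rfl (Finset.sum_le_sum
          fun (i : Fin (⌊t / h⌋₊ + 1) × (Fin 3 → Fin m)) _ =>
            hfix _ (floorChain_timeGrid_mem hh ht.le i.1) _)
    _ = μ {z | z ∉ G ∨ cap < E z} + (((⌊t / h⌋₊ + 1) * m ^ 3 : ℕ) : ℝ≥0∞) * d := by
        simp only [Finset.sum_const, Finset.card_univ, Fintype.card_prod, Fintype.card_fin,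
          Fintype.card_fun, nsmul_eq_mul]

/-! ## Counting the grid -/

/-- **Grid parameters at scale `X ≥ 1`.** With `Lip = √3 C X`, `m = ⌈4 Lip/c₁⌉₊ + 1` and
`h = c₁/(4 Lip √(2K) + 1)`: `Lip/m ≤ c₁/4`, `Lip √(2K) h ≤ c₁/4`, and the grid has
`(⌊t/h⌋₊ + 1) m³ ≤ A X⁴` points, `A` depending on `t, C, K, c₁` only. -/
theorem floorChain_grid_params_of_le {C c₁ t X : ℝ} (K : ℝ) (hC : 0 ≤ C) (ht : 0 < t)
    (hc₁ : 0 < c₁) (hX1 : 1 ≤ X) :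
    ∃ (m : ℕ) (h : ℝ), 0 < m ∧ 0 < h ∧
      Real.sqrt 3 * (C * X) * (1 / (m : ℝ)) ≤ c₁ / 4 ∧
      Real.sqrt 3 * (C * X) * Real.sqrt (2 * K) * h ≤ c₁ / 4 ∧
      (((⌊t / h⌋₊ + 1) * m ^ 3 : ℕ) : ℝ) ≤
        (4 * t * Real.sqrt 3 * C * Real.sqrt (2 * K) / c₁ + (t / c₁ + 1)) *
          (4 * Real.sqrt 3 * C / c₁ + 2) ^ 3 * X ^ 4 := by
  have hX0 : 0 ≤ X := zero_le_one.trans hX1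
  obtain ⟨L, hL⟩ : ∃ L : ℝ, L = Real.sqrt 3 * (C * X) := ⟨_, rfl⟩
  obtain ⟨Q, hQ⟩ : ∃ Q : ℝ, Q = L * Real.sqrt (2 * K) := ⟨_, rfl⟩
  have hL0 : 0 ≤ L := by rw [hL]; positivity
  have hQ0 : 0 ≤ Q := by rw [hQ]; positivity
  rw [← hL, ← hQ]
  refine ⟨⌈4 * L / c₁⌉₊ + 1, c₁ / (4 * Q + 1), Nat.succ_pos _, by positivity, ?_, ?_, ?_⟩
  · have hmc : 4 * L / c₁ ≤ ((⌈4 * L / c₁⌉₊ + 1 : ℕ) : ℝ) :=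
      (Nat.le_ceil _).trans (by push_cast; linarith)
    have hmpos : (0 : ℝ) < ((⌈4 * L / c₁⌉₊ + 1 : ℕ) : ℝ) := by positivity
    rw [div_le_iff₀ hc₁] at hmc
    rw [mul_one_div, div_le_div_iff₀ hmpos (by norm_num : (0 : ℝ) < 4)]
    linarith
  · rw [mul_div_assoc', div_le_div_iff₀ (by positivity) (by norm_num : (0 : ℝ) < 4)]
    nlinarith
  · have hfl : (⌊t / (c₁ / (4 * Q + 1))⌋₊ : ℝ) ≤ t / (c₁ / (4 * Q + 1)) :=
      Nat.floor_le (by positivity)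
    rw [div_div_eq_mul_div] at hfl
    have hceil : (⌈4 * L / c₁⌉₊ : ℝ) < 4 * L / c₁ + 1 := Nat.ceil_lt_add_one (by positivity)
    have hm_le : ((⌈4 * L / c₁⌉₊ + 1 : ℕ) : ℝ) ≤ (4 * Real.sqrt 3 * C / c₁ + 2) * X := by
      push_cast
      have e1 : 4 * L / c₁ = 4 * Real.sqrt 3 * C / c₁ * X := by rw [hL]; ring
      have e2 : (4 * Real.sqrt 3 * C / c₁ + 2) * X = 4 * Real.sqrt 3 * C / c₁ * X + 2 * X := by
        ring
      linarith
    have hT_le : (⌊t / (c₁ / (4 * Q + 1))⌋₊ : ℝ) + 1 ≤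
        (4 * t * Real.sqrt 3 * C * Real.sqrt (2 * K) / c₁ + (t / c₁ + 1)) * X := by
      have e1 : t * (4 * Q + 1) / c₁ =
          4 * t * Real.sqrt 3 * C * Real.sqrt (2 * K) / c₁ * X + t / c₁ := by
        rw [hQ, hL]; ring
      have e2 : t / c₁ + 1 ≤ (t / c₁ + 1) * X := le_mul_of_one_le_right (by positivity) hX1
      have e3 : (4 * t * Real.sqrt 3 * C * Real.sqrt (2 * K) / c₁ + (t / c₁ + 1)) * X =
          4 * t * Real.sqrt 3 * C * Real.sqrt (2 * K) / c₁ * X + (t / c₁ + 1) * X := by ring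
      linarith
    calc (((⌊t / (c₁ / (4 * Q + 1))⌋₊ + 1) * (⌈4 * L / c₁⌉₊ + 1) ^ 3 : ℕ) : ℝ)
        = ((⌊t / (c₁ / (4 * Q + 1))⌋₊ : ℝ) + 1) * ((⌈4 * L / c₁⌉₊ + 1 : ℕ) : ℝ) ^ 3 := by
          push_cast; ring
      _ ≤ ((4 * t * Real.sqrt 3 * C * Real.sqrt (2 * K) / c₁ + (t / c₁ + 1)) * X) *
            ((4 * Real.sqrt 3 * C / c₁ + 2) * X) ^ 3 :=
          mul_le_mul hT_le (pow_le_pow_left₀ (by positivity) hm_le 3) (by positivity)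
            (by positivity)
      _ = (4 * t * Real.sqrt 3 * C * Real.sqrt (2 * K) / c₁ + (t / c₁ + 1)) *
            (4 * Real.sqrt 3 * C / c₁ + 2) ^ 3 * X ^ 4 := by ring

/-- **Grid parameters at level `N`.** The grid of `floorChain_grid_params_of_le` at scale
`X = (N+1)^{4γ}` has `≤ A (N+1)²` points for `16γ ≤ 2` (`γ ≤ 1/15`). -/
theorem floorChain_exists_grid_params {γ C c₁ t : ℝ} (K : ℝ) (hγ : 0 < γ) (hγ' : γ ≤ 1 / 15)
    (hC : 0 ≤ C) (ht : 0 < t) (hc₁ : 0 < c₁) :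
    ∃ A : ℝ, 0 ≤ A ∧ ∀ N : ℕ, ∃ (m : ℕ) (h : ℝ), 0 < m ∧ 0 < h ∧
      Real.sqrt 3 * (C * ((N : ℝ) + 1) ^ (4 * γ)) * (1 / (m : ℝ)) ≤ c₁ / 4 ∧
      Real.sqrt 3 * (C * ((N : ℝ) + 1) ^ (4 * γ)) * Real.sqrt (2 * K) * h ≤ c₁ / 4 ∧
      (((⌊t / h⌋₊ + 1) * m ^ 3 : ℕ) : ℝ) ≤ A * ((N : ℝ) + 1) ^ 2 := by
  refine ⟨(4 * t * Real.sqrt 3 * C * Real.sqrt (2 * K) / c₁ + (t / c₁ + 1)) *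
      (4 * Real.sqrt 3 * C / c₁ + 2) ^ 3, by positivity, fun N => ?_⟩
  have hN1 : (1 : ℝ) ≤ (N : ℝ) + 1 := le_add_of_nonneg_left (Nat.cast_nonneg N)
  have hX1 : 1 ≤ ((N : ℝ) + 1) ^ (4 * γ) := Real.one_le_rpow hN1 (by positivity)
  obtain ⟨m, h, hm, hh, h1, h2, h3⟩ := floorChain_grid_params_of_le (t := t) K hC ht hc₁ hX1
  refine ⟨m, h, hm, hh, h1, h2, h3.trans (mul_le_mul_of_nonneg_left ?_ (by positivity))⟩
  calc (((N : ℝ) + 1) ^ (4 * γ)) ^ 4 = ((N : ℝ) + 1) ^ (4 * γ * 4) := by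
        rw [← Real.rpow_natCast _ 4, ← Real.rpow_mul (by positivity) (4 * γ)]
        push_cast
        ring_nf
    _ ≤ ((N : ℝ) + 1) ^ (2 : ℝ) := Real.rpow_le_rpow_of_exponent_le hN1 (by linarith)
    _ = ((N : ℝ) + 1) ^ 2 := Real.rpow_two _

/-! ## The stub -/

/-- STUB `floorChain` of the line `Sketch` (crux `AprioriBounds`, stmt-AtomisticToContinuum-14827;
reshape r3): a FIXED-`(s, x)` floor bound `P_N{ρ̄_N(Φ_s z, x) < c₁} ≤ δ_N` with `(N+1)² δ_N → 0`,
the deterministic space–time modulus of the block densities on good orbits of energy `≤ K(N+1)`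
(Lipschitz constant `√3 · C (N+1)^{4γ}` in the centre, times `√(2K)` in time) and the cap
`P_N{z ∉ good ∨ K(N+1) < E(z)} → 0` give the UNIFORM floor at level `c₁/2`:
`P_N{∃ s ∈ [0,t], ∃ x, ρ̄_N(Φ_s z, x) < c₁/2} → 0`.  Proof: a space–time grid of
`O((N+1)^{16γ}) ≤ O((N+1)²)` points (`γ ≤ 1/15`) at space mesh `c₁/(4 Lip)` and time mesh
`c₁/(4 Lip √(2K))`, the modulus, and a union bound. -/
theorem stub_floorChain :
    ∀ (σ : ℝ) (Φ : (N : ℕ) → HardSphereFlow (Torus.geometry (Fin 3)) (hsDiameter σ N) (N + 1))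
      (P : (N : ℕ) → Measure (Config (N + 1) (Fin 3) T3))
      (φ : ℕ → T3 → ℝ) (γ C t c₁ K : ℝ) (δ : ℕ → ℝ),
      0 < γ → γ ≤ 1 / 15 → 0 ≤ C → 0 < t → 0 < c₁ → 0 ≤ K →
      (∀ (N : ℕ), ∀ z ∈ (Φ N).good, configEnergy z ≤ K * ((N : ℝ) + 1) →
        ∀ (s s' : ℝ) (x x' : T3),
          |empiricalDensityField ((Φ N).flow s z) (fun y => φ N (y - x)) -
              empiricalDensityField ((Φ N).flow s' z) (fun y => φ N (y - x'))| ≤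
            Real.sqrt 3 * (C * ((N : ℝ) + 1) ^ (4 * γ)) * (‖x - x'‖ + |s - s'| * Real.sqrt (2 * K))) →
      Tendsto (fun N : ℕ => P N {z | z ∉ (Φ N).good ∨ K * ((N : ℝ) + 1) < configEnergy z}) atTop (𝓝 0) →
      Tendsto (fun N : ℕ => ((N : ℝ) + 1) ^ 2 * δ N) atTop (𝓝 0) →
      (∀ (N : ℕ), ∀ s ∈ Icc 0 t, ∀ x : T3,
        P N {z | empiricalDensityField ((Φ N).flow s z) (fun y => φ N (y - x)) < c₁} ≤
          ENNReal.ofReal (δ N)) →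
      Tendsto (fun N : ℕ => P N {z | ∃ s ∈ Icc 0 t, ∃ x : T3,
        empiricalDensityField ((Φ N).flow s z) (fun y => φ N (y - x)) < c₁ / 2}) atTop (𝓝 0) := by
  intro σ Φ P φ γ C t c₁ K δ hγ hγ' hC ht hc₁ _hK hmod hcap hδ hfix
  obtain ⟨A, hA, hgrid⟩ := floorChain_exists_grid_params (t := t) K hγ hγ' hC ht hc₁
  -- the bound at every `N`
  have hbound : ∀ N : ℕ,
      P N {z | ∃ s ∈ Icc 0 t, ∃ x : T3,
          empiricalDensityField ((Φ N).flow s z) (fun y => φ N (y - x)) < c₁ / 2} ≤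
        P N {z | z ∉ (Φ N).good ∨ K * ((N : ℝ) + 1) < configEnergy z} +
          ENNReal.ofReal (A * (((N : ℝ) + 1) ^ 2 * |δ N|)) := by
    intro N
    obtain ⟨m, h, hm, hh, hsp, hti, hcard⟩ := hgrid N
    refine (floorChain_measure_le (P N) (Φ N).good configEnergy (K * ((N : ℝ) + 1))
      (fun s z x => empiricalDensityField ((Φ N).flow s z) (fun y => φ N (y - x)))
      (by positivity) (Real.sqrt_nonneg _) ht hh hm (hmod N) hsp hti
      (fun s hs x => hfix N s hs x)).trans ?_
    refine add_le_add le_rfl ?_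
    calc ((((⌊t / h⌋₊ + 1) * m ^ 3 : ℕ) : ℝ≥0∞)) * ENNReal.ofReal (δ N)
        ≤ ENNReal.ofReal (((⌊t / h⌋₊ + 1) * m ^ 3 : ℕ) : ℝ) * ENNReal.ofReal |δ N| := by
          rw [ENNReal.ofReal_natCast]
          exact mul_le_mul' le_rfl (ENNReal.ofReal_le_ofReal (le_abs_self _))
      _ = ENNReal.ofReal ((((⌊t / h⌋₊ + 1) * m ^ 3 : ℕ) : ℝ) * |δ N|) :=
          (ENNReal.ofReal_mul (Nat.cast_nonneg _)).symm
      _ ≤ ENNReal.ofReal (A * (((N : ℝ) + 1) ^ 2 * |δ N|)) := by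
          refine ENNReal.ofReal_le_ofReal ?_
          rw [← mul_assoc]
          exact mul_le_mul_of_nonneg_right hcard (abs_nonneg _)
  -- the majorant tends to `0`
  have hlim : Tendsto (fun N : ℕ =>
      P N {z | z ∉ (Φ N).good ∨ K * ((N : ℝ) + 1) < configEnergy z} +
        ENNReal.ofReal (A * (((N : ℝ) + 1) ^ 2 * |δ N|))) atTop (𝓝 0) := by
    have h1 : Tendsto (fun N : ℕ => A * (((N : ℝ) + 1) ^ 2 * |δ N|)) atTop (𝓝 0) := by
      have h0 := (hδ.abs).const_mul A
      rw [abs_zero, mul_zero] at h0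
      refine h0.congr fun N => ?_
      rw [abs_mul, abs_of_nonneg (by positivity)]
    have h2 := ENNReal.tendsto_ofReal h1
    rw [ENNReal.ofReal_zero] at h2
    simpa using hcap.add h2
  exact tendsto_of_tendsto_of_tendsto_of_le_of_le tendsto_const_nhds hlim (fun N => zero_le)
    hbound

end Summit.AtomisticToContinuum.HydrodynamicLimit.Theorems.AdiabatCeiling
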